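import Literature.AlgebraicGeometry.HodgeTheory.AtiyahClassTraceReal
import HarnessLib

/-!
# Naturality of the trace with coefficients `Tr_G : Extⁱ(E, 𝓗om(E^∨, G)) → Hⁱ(X, G)` in `G`

`HodgeTheory/AtiyahClassTraceReal.lean` constructs, for a finite locally free `𝒪_X`-module `E` on a scheme
`X` and any `𝒪_X`-module `G`, the trace with coefficients
`traceExtCoeff hE G i : Extⁱ(E, 𝓗om(E^∨, G)) → Extⁱ(𝒪_X, G)` and `traceCoeffToCohomology hE G i` (values in
`Hⁱ(X, G)`), from the contraction `Modules.contract hE G : 𝓗om(E, 𝓗om(E^∨, G)) → G`. This file PROVES that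
all three are natural in the coefficients `G` (Buchweitz–Flenner §4: the trace maps are compatible with the
module structures / morphisms of coefficients), which is what identifies traces taken with isomorphic
coefficient sheaves (e.g. `Ω¹` versus `⋀¹ Ω¹`, `𝒪_X` versus `Ω⁰` in `HodgeTheory/SemiregularityHigherSigma.lean`):

* `frameContract_comp_over_map` — `∑_i B(b_i)(λ_i)` is natural in `G`;
* `sheafHomMap_sheafHomMap_comp_contract` — `𝓗om(E, 𝓗om(E^∨, g)) ≫ c_{G'} = c_G ≫ g`;
* `traceExtCoeff_comp_mk₀` — `Tr_{G'}(y · 𝓗om(E^∨, g)) = Tr_G(y) · g`;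
* `traceCoeffToCohomology_comp_mk₀` — the same with values in sheaf cohomology (`Sheaf.H.map`);
* `sheafH_map_hom_map_inv` — `H(e.hom) ∘ H(e.inv) = id` for an isomorphism of abelian sheaves.

Everything is proved; no definitions, no named facts.

## References

* R.-O. Buchweitz, H. Flenner, *A semiregularity map for modules and applications to deformations*,
  Compositio Math. 137 (2003), §4 (trace map). [BuchweitzFlenner2003]
* R. Hartshorne, *Algebraic Geometry* (1977), II Ex. 5.1 (b) (the contraction). [Hartshorne1977]
-/

noncomputable section

open CategoryTheory CategoryTheory.Abelian AlgebraicGeometry Opposite TopologicalSpace Limits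

namespace Literature.AlgebraicGeometry.HodgeTheory

open Literature.AlgebraicGeometry.Modules Literature.AlgebraicGeometry.Motives

universe w u

/-! ### Naturality of the contraction and of the trace with coefficients in `G` -/

section TraceNaturality

variable {Y : Scheme.{u}} {E G G' : Y.Modules}

/-- The frame contraction `∑_i B(b_i)(λ_i)` is natural in the coefficients `G`. [folklore] -/
lemma frameContract_comp_over_map {W : Y.Opens} {I : Type u} [Fintype I]
    (e : SheafOfModules.free I ≅ E.over W) (g : G ⟶ G')
    (B : E.over W ⟶ (sheafHom (dual E) G).over W) :
    frameContract G' e (B ≫ (SheafOfModules.overFunctor _ W).map (sheafHomMap (dual E) g)) =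
      g.app W (frameContract G e B) := by
  unfold frameContract
  rw [map_sum]
  refine Finset.sum_congr rfl fun i _ => ?_
  rw [appLE_comp, appLE_over_map, sheafHomMap_app_apply, appLE_comp, appLE_over_map]

/-- **The contraction `𝓗om(E, 𝓗om(E^∨, G)) → G` is natural in `G`** (`E` finite locally free):
for `g : G → G'`, `𝓗om(E, 𝓗om(E^∨, g)) ≫ c_{G'} = c_G ≫ g`. [folklore] -/
theorem sheafHomMap_sheafHomMap_comp_contract (hE : IsFiniteLocallyFree E) (g : G ⟶ G') :
    sheafHomMap E (sheafHomMap (dual E) g) ≫ contract hE G' = contract hE G ≫ g := by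
  refine Scheme.Modules.hom_ext _ _ fun U => AddCommGrpCat.ext
    fun (B : E.over U ⟶ (sheafHom (dual E) G).over U) => ?_
  change contractValue hE G' U ((sheafHomMap E (sheafHomMap (dual E) g)).app U B) =
    g.app U (contractValue hE G U B)
  rw [sheafHomMap_app_apply]
  symm
  refine eq_contractValue hE G' U _ fun x => ?_
  rw [contractPieces, restrictHom_comp, restrictHom_over_map, frameContract_comp_over_map,
    ← contractPieces, ← map_contractValue_piece]
  exact (PresheafOfModules.naturality_apply g.val (Opens.infLELeft U (trivNbhd hE x.1)).op
    (contractValue hE G U B)).symm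

variable [HasExt.{w} Y.Modules] (hE : IsFiniteLocallyFree E)

/-- **The trace with coefficients is natural in the coefficients**: for `g : G → G'` and
`y ∈ Extⁱ(E, 𝓗om(E^∨, G))`, `Tr_{G'}(y · 𝓗om(E^∨, g)) = Tr_G(y) · g` in `Extⁱ(𝒪_X, G')`
(Buchweitz–Flenner §4: the trace maps are "compatible with … morphisms"; here from
`sheafHomMap_sheafHomMap_comp_contract`). [cite: BuchweitzFlenner2003, §4 (trace map)] -/
theorem traceExtCoeff_comp_mk₀ (g : G ⟶ G') (i : ℕ) (y : Ext.{w} E (sheafHom (dual E) G) i) :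
    traceExtCoeff hE G' i (y.comp (Ext.mk₀ (sheafHomMap (dual E) g)) (add_zero i)) =
      (traceExtCoeff hE G i y).comp (Ext.mk₀ g) (add_zero i) := by
  haveI := preservesFiniteColimits_sheafHomFunctor E hE
  have hnat : (Ext.mk₀ ((sheafHomFunctor E).map (sheafHomMap (dual E) g))).comp
      (Ext.mk₀ (contract hE G')) (zero_add 0) =
      (Ext.mk₀ (X := (sheafHomFunctor E).obj (sheafHom (dual E) G)) (contract hE G)).comp
        (Ext.mk₀ g) (zero_add 0) := by
    rw [Ext.mk₀_comp_mk₀, Ext.mk₀_comp_mk₀]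
    exact congrArg Ext.mk₀ (sheafHomMap_sheafHomMap_comp_contract hE g)
  rw [traceExtCoeff_apply, traceExtCoeff_apply, Ext.mapExactFunctor_comp, Ext.mapExactFunctor_mk₀,
    Ext.comp_assoc_of_third_deg_zero (y.mapExactFunctor (sheafHomFunctor E)), hnat,
    ← Ext.comp_assoc_of_third_deg_zero (y.mapExactFunctor (sheafHomFunctor E))]
  exact (Ext.comp_assoc_of_third_deg_zero _ _ _ _).symm

/-- **The trace with coefficients to sheaf cohomology is natural in the coefficients**:
`Tr_{G'}(y · 𝓗om(E^∨, g)) = H(g)(Tr_G(y))` in `Hⁱ(X, G')`. [cite: BuchweitzFlenner2003, §4 (trace map)] -/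
theorem traceCoeffToCohomology_comp_mk₀ (g : G ⟶ G') (i : ℕ)
    (y : Ext.{w} E (sheafHom (dual E) G) i) :
    traceCoeffToCohomology hE G' i (y.comp (Ext.mk₀ (sheafHomMap (dual E) g)) (add_zero i)) =
      Sheaf.H.map ((modulesToSheaf Y).map g) i (traceCoeffToCohomology hE G i y) := by
  rw [Sheaf.H.map_apply, traceCoeffToCohomology, traceCoeffToCohomology, AddMonoidHom.comp_apply,
    AddMonoidHom.comp_apply, traceExtCoeff_comp_mk₀, extToCohomology_comp_mk₀]

end TraceNaturality

/-! ### Transport of sheaf cohomology along an isomorphism and its inverse -/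

section HTransport

variable {C : Type*} [Category C] {J : GrothendieckTopology C} [HasSheafify J AddCommGrpCat.{u}]
  [HasExt.{w} (Sheaf J AddCommGrpCat.{u})]

/-- `H(e.hom) ∘ H(e.inv) = id` on sheaf cohomology, for an isomorphism `e` of abelian sheaves.
[folklore] -/
lemma sheafH_map_hom_map_inv {F G : Sheaf J AddCommGrpCat.{u}} (e : F ≅ G) (n : ℕ) (x : G.H n) :
    Sheaf.H.map e.hom n (Sheaf.H.map e.inv n x) = x := by
  rw [← Sheaf.H.map_comp_apply, Iso.inv_hom_id, Sheaf.H.map_id_apply]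

end HTransport

end Literature.AlgebraicGeometry.HodgeTheory

end
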